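import Mathlib.Algebra.BigOperators.Field
import Mathlib.Algebra.BigOperators.Ring.Finset
import Mathlib.Data.Fintype.BigOperators
import Mathlib.Data.PNat.Basic
import Mathlib.Tactic.FieldSimp
import Mathlib.Tactic.Ring
import Literature.IUT.LogThetaLattice.PacketWeights
import HarnessLib

/-!
# The fork at [IUTchIII] Corollary 3.12 — section-weighted sums (Mochizuki) vs. averages over all places (Dupuy–Hilado)

Record-only file (D-0012) of the abc-iut cell (Cor. 3.12 sub-crew, wave 2, seat abc-iut-c312-6, board row W2-C); TAKES NO SIDE.
One of the two items the verbatim ↔ Dupuy–Hilado identification `Cor312Vol.VerbatimDHAgreement` has to absorb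
(`Cor312Bridge` docstring) is a difference of BOOKKEEPING between the two texts at a tensor packet over `v_ℚ = p` with
capsule index set `A`:

* [IUTchIII] Rmk. 3.1.1 (ii), kurims p. 94 (L6-t4 `packetWeightTensor`): the log-volume of the summand indexed by a
  collection `{v_α}_{α∈A}` of elements of `𝕍` — ONE chosen valuation of `K` over each valuation of `F_mod` (the "local
  analytic section" `𝕍 ⥲ 𝕍_mod` of [IUTchI] Def. 3.1 (e)) — is weighted by
  `1 / ((Π_α [K_{v_α} : (F_mod)_{v_α}]) · Σ_{{w_α}} Π_α [(F_mod)_{w_α} : ℚ_p])`, and `Σ_{{w_α}} Π_α [(F_mod)_{w_α} : ℚ_p] = [F_mod : ℚ]^{#A}`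
  (L6-t4 `sum_prod_degF_eq_pow`);
* Dupuy–Hilado §3.4–3.6 (c312-3 `PacketModel.lnνTensorPower`, `verbatim_weight_eq_dh_weight`): the expectation over ALL
  tuples `w⃗` of places of the field over `p` of `log μ̄_{w⃗} = log μ_{w⃗} / dim_{ℚ_p}`, with `Pr(w⃗) = Π_k [K_{w_k}:ℚ_p]/[K:ℚ]` — i.e. the
  uniform coefficient `1/[K:ℚ]^{#A}` on `log μ_{w⃗}`.

THIS FILE PROVES when the two agree (`dh_average_eq_section_sum`, `dh_average_eq_packetWeightTensor_sum`): if every fibre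
of `π : 𝕍(K)_p → 𝕍(F_mod)_p` has (number of places) × (local degree) `= [K : F_mod]` — the shape of the fibres when `K/F_mod`
is GALOIS ([IUTchI] Def. 3.1: `K` Galois over `F_mod`), with the local degree read at the section — and the summand
log-volumes are constant on the fibres of `π` (Galois-conjugate tuples of places carry regions of equal volume), then
Dupuy–Hilado's all-places average with coefficient `1/([K:F_mod]·[F_mod:ℚ])^{#A}` EQUALS Mochizuki's section sum with the
normalized weights of Rmk. 3.1.1 (ii). Pure finite bookkeeping (no number fields are needed: fibre sizes and degrees are
abstract naturals), so the identification hypothesis of `Cor312FormsBridge` reduces, for this item, to the two named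
conditions. Dupuy–Hilado Rmk. 3.5.4: "The property of being Mochizuki normalized does not uniquely specify the weights of
our expectations. This is a common misconception." — the lemma says which weights DO reproduce Mochizuki's.
[claim: Mochizuki2012, status: disputed] [cite: DupuyHilado2025, §3.4–3.6, Rmk. 3.5.4]
Deliberately NOT here: that the regions of Cor. 3.12 ARE fibre-invariant, or that the fibres of an actual `K/F_mod` have
the stated shape (Mathlib: `Ideal.sum_ramification_inertia` and Galois transitivity — campaign work); any judgement.
-/

namespace Summit.ABC

namespace IUTFork

namespace Cor312Vol

open Finset

/-- The number of tuples `w⃗ : A → 𝕍(K)_p` lying over a tuple `v⃗ : A → 𝕍(F_mod)_p` is the product of the fibre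
cardinalities. [folklore] -/
theorem card_tuples_over {A W V : Type*} [Fintype A] [DecidableEq A] [Fintype W] [DecidableEq V]
    (π : W → V) (v : A → V) :
    Fintype.card {w : A → W // π ∘ w = v} = ∏ a, Fintype.card {x : W // π x = v a} := by
  rw [← Fintype.card_pi]
  exact Fintype.card_congr
    ((Equiv.subtypeEquivRight fun w => show π ∘ w = v ↔ ∀ a, π (w a) = v a from funext_iff).trans
      (Equiv.subtypePiEquivPi (β := fun _ : A => W) (p := fun a (x : W) => π x = v a)))

/-- **Dupuy–Hilado's average over ALL tuples of places = Mochizuki's SECTION-weighted sum.** Hypotheses: every fibre of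
`π : 𝕍(K)_p → 𝕍(F_mod)_p` satisfies `#π⁻¹(v) · d(v) = n` (`d(v) = [K_v : (F_mod)_v]` at the section, `n = [K : F_mod] ≥ 1`; the
Galois shape), and the summand quantity `G` depends only on the tuple of places of `F_mod` (fibre-invariance). Then
`Σ_{w⃗} G(π∘w⃗) / (n·m)^{#A} = Σ_{v⃗} G(v⃗) / ((Π_α d(v_α)) · m^{#A})` (`m = [F_mod : ℚ]`, so `n·m = [K : ℚ]`).
[cite: DupuyHilado2025, §3.6] -/
theorem dh_average_eq_section_sum {A W V : Type*} [Fintype A] [DecidableEq A] [Fintype W]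
    [Fintype V] [DecidableEq V] (π : W → V) (n : ℕ) (hn : 0 < n) (d : V → ℕ+)
    (hgd : ∀ v, Fintype.card {x : W // π x = v} * (d v : ℕ) = n) (m : ℝ) (hm : m ≠ 0) (G : (A → V) → ℝ) :
    ∑ w : A → W, G (π ∘ w) / (((n : ℝ) * m) ^ Fintype.card A) =
      ∑ v : A → V, G v / ((∏ a, (d (v a) : ℝ)) * m ^ Fintype.card A) := by
  have hd : ∀ v : V, (0 : ℝ) < (d v : ℝ) := fun v => by exact_mod_cast (d v).pos
  have hcard : ∀ v : V, (Fintype.card {x : W // π x = v} : ℝ) = (n : ℝ) / (d v : ℝ) := fun v => by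
    rw [eq_div_iff (hd v).ne']
    exact_mod_cast hgd v
  rw [← Fintype.sum_fiberwise' (fun w : A → W => π ∘ w)
    (fun v => G v / (((n : ℝ) * m) ^ Fintype.card A))]
  refine Finset.sum_congr rfl fun v _ => ?_
  rw [Finset.sum_const, Finset.card_univ, card_tuples_over, nsmul_eq_mul, Nat.cast_prod]
  simp_rw [hcard]
  rw [Finset.prod_div_distrib, Finset.prod_const, Finset.card_univ, mul_pow]
  have hP : (∏ a, (d (v a) : ℝ)) ≠ 0 := (Finset.prod_pos fun a _ => hd (v a)).ne'
  have hn' : (n : ℝ) ≠ 0 := by exact_mod_cast hn.ne'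
  field_simp

open Literature.IUT.LogThetaLattice in
/-- The same identity with the right-hand side written with L6-t4's `packetWeightTensor` ([IUTchIII] Rmk. 3.1.1 (ii),
third display, p. 94): `Σ_{w⃗} G(π∘w⃗)/(n · Σ_u [(F_mod)_u:ℚ_p])^{#A} = Σ_{v⃗} packetWeightTensor degF degKF v⃗ · G(v⃗)`, where
`degKF = d` are the local degrees `[K_v:(F_mod)_v]` at the section and `degF u = [(F_mod)_u : ℚ_p]` (so
`Σ_u degF u = [F_mod:ℚ]`, `sum_prod_degF_eq_pow`). [claim: Mochizuki2012, status: disputed] -/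
theorem dh_average_eq_packetWeightTensor_sum {A W V : Type*} [Fintype A] [DecidableEq A] [Fintype W]
    [Fintype V] [DecidableEq V] [Nonempty V] (π : W → V) (n : ℕ) (hn : 0 < n)
    (degF degKF : V → ℕ+) (hgd : ∀ v, Fintype.card {x : W // π x = v} * (degKF v : ℕ) = n)
    (G : (A → V) → ℝ) :
    ∑ w : A → W, G (π ∘ w) / (((n : ℝ) * ∑ u, (degF u : ℝ)) ^ Fintype.card A) =
      ∑ v : A → V, packetWeightTensor degF degKF v * G v := by
  have hS : (0 : ℝ) < ∑ u, (degF u : ℝ) :=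
    Finset.sum_pos (fun u _ => by exact_mod_cast (degF u).pos) Finset.univ_nonempty
  rw [dh_average_eq_section_sum π n hn degKF hgd _ hS.ne' G]
  refine Finset.sum_congr rfl fun v _ => ?_
  show G v / ((∏ a, (degKF (v a) : ℝ)) * (∑ u, (degF u : ℝ)) ^ Fintype.card A) =
    packetWeightTensor degF degKF v * G v
  unfold packetWeightTensor
  rw [sum_prod_degF_eq_pow, div_eq_mul_one_div, mul_comm]

end Cor312Vol

end IUTFork

end Summit.ABC
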